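import Literature.Computability.Cryptography.HallgrenWalkParams
import HarnessLib

/-!
# Hallgren's post-processor is correct on a good pair of samples: the concrete instance

Topic `Computability/Cryptography`; discharges the walk-adequacy hypotheses of
`HallgrenPostCorrect.exists_true_cand` / `result_eq_floor_or_ceil` for the concrete walk
(`hallgrenOps`, `hallgrenW`, the cycle `cyc` of `D = fundDiscr d`) with the inequalities of
`HallgrenParams.lean`. Result (`result_correct_of_goodPair`): if the quantum core's output carries, on
two distinct units of a common block length `L ≥ 4n + 64`, the rounded harmonics `kQ/S`, `lQ/S` of a
coprime pair `k, l ≤ S = N log ε` (`N = 2^{2|x|+28}`), then the post-processor outputs `⌊R⌋` or `⌈R⌉`, `R = log ε`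
(Jozsa 2003, §10 Thm. 6 with step (c)). Theorem-and-definition file, no named facts.

## References

* R. Jozsa, arXiv:quant-ph/0302134 (2003), §3, §9, §10. [Jozsa2003]
-/

noncomputable section

open scoped Classical

namespace Literature.Computability.Cryptography

namespace HallgrenGiantStep

open _root_.Computability Literature.Computability.Complexity Literature.NumberTheory.QuadraticFields
  Literature.NumberTheory.QuadraticFields.QuadIrr PeriodFinding HallgrenPost InfraPrimitives GiantStepCycle

/-! ### The discriminant of a squarefree input -/

/-- `D = fundDiscr d` is a good discriminant for squarefree `d ≥ 2`. [cite: Jozsa2003, §3] -/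
theorem goodD_Dof {d : ℕ} (hsf : Squarefree d) (h2 : 2 ≤ d) : ¬ IsSquare (Dof d) ∧ (Dof d % 4 = 0 ∨ Dof d % 4 = 1) :=
  ⟨Quadratic.not_isSquare_fundDiscr_toNat hsf h2, Quadratic.fundDiscr_toNat_mod_four d⟩

/-- `Dof d ≤ 4d`. [folklore] -/
theorem Dof_le (d : ℕ) : Dof d ≤ 4 * d := by rw [Dof_eq]; split_ifs <;> omega

/-- `size (Dof (decodeNat x)) ≤ |x| + 3`. [folklore] -/
theorem size_Dof_le (x : List Bool) : (Dof (decodeNat x)).size ≤ x.length + 3 := by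
  have h1 : decodeNat x < 2 ^ (x.length + 1) := by
    rw [← bitsToNat_canonBits]
    have h := bitsToNat_lt (canonBits x)
    have hl : (canonBits x).length ≤ x.length + 1 := by
      unfold canonBits; split_ifs <;> simp
    exact lt_of_lt_of_le h (Nat.pow_le_pow_right (by norm_num) hl)
  have h2 : Dof (decodeNat x) < 2 ^ (x.length + 3) := by
    have := Dof_le (decodeNat x)
    calc Dof (decodeNat x) ≤ 4 * decodeNat x := this
      _ < 4 * 2 ^ (x.length + 1) := by omega
      _ = 2 ^ (x.length + 3) := by ring
  exact Nat.size_le.mpr h2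

/-! ### The cycle of the input -/

variable {d : ℕ} (hsf : Squarefree d) (h2 : 2 ≤ d)

/-- The cycle of the input's discriminant with the precision used for the input `x`. [folklore] -/
abbrev cycD (hsf : Squarefree d) (h2 : 2 ≤ d) (q : Polynomial ℕ) (x : List Bool) : GiantStepCycle (ℤ × ℤ) :=
  cyc (goodD_Dof hsf h2).1 (goodD_Dof hsf h2).2 (TOf (Dof d) + coreLen x + q.eval (coreLen x)) (2 * x.length + 30)

include hsf h2

/-- The cycle presents the walk data of the input's instance. [folklore] -/
theorem cycD_toWalkData (q : Polynomial ℕ) {x : List Bool} (hx : decodeNat x = d) :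
    (cycD hsf h2 q x).toWalkData = hallgrenOps.toWalkData ((hallgrenW q).dOf x) := by
  show (cycD hsf h2 q x).toWalkData =
    hallgrenOps.toWalkData (Dof (decodeNat x), precOf (Dof (decodeNat x))
      (TOf (Dof (decodeNat x)) + coreLen x + q.eval (coreLen x)) + (2 * x.length + 30))
  rw [hx]; rfl

omit hsf h2 in
/-- The grid of the input. [folklore] -/
theorem hallgrenW_N (q : Polynomial ℕ) (x : List Bool) : ((hallgrenW q).N x : ℝ) = (2 : ℝ) ^ (2 * x.length + 28) := by
  show ((gridN x : ℕ) : ℝ) = _; rw [gridN_eq]; push_cast; ring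

omit hsf h2 in
/-- The grid is at least `4096`. [folklore] -/
theorem hallgrenW_N_ge (q : Polynomial ℕ) (x : List Bool) : 4096 ≤ (hallgrenW q).N x := by
  show 4096 ≤ gridN x
  rw [gridN_eq]
  calc (4096 : ℕ) = 2 ^ 12 := by norm_num
    _ ≤ 2 ^ (2 * x.length + 28) := Nat.pow_le_pow_right (by norm_num) (by omega)

/-- **`Q = 2^L ≥ 3S²`** for `L ≥ 6n + 100` (`S = 2^{2|x|+28} · log ε ≤ 2^{2|x| + 3 size D + 30}`,
`size D ≤ |x| + 3`). [cite: Jozsa2003, §10 (q ≥ 3S²)] -/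
theorem three_S_sq_le (q : Polynomial ℕ) {x : List Bool} (hx : decodeNat x = d) {L : ℕ} (hL : 6 * coreLen x + 100 ≤ L) :
    3 * (((hallgrenW q).N x : ℝ) * (cycD hsf h2 q x).R) ^ 2 ≤ (2 ^ L : ℕ) := by
  obtain ⟨hD, hD4⟩ := goodD_Dof hsf h2
  have hR := HallgrenRegulator.log_fundUnit_le hD hD4
  rw [show (cycD hsf h2 q x).R = Real.log (fundUnit (Dof d)) from rfl, hallgrenW_N]
  set D := Dof d with hDdef
  have hD1 : (1 : ℝ) ≤ D := by exact_mod_cast le_trans (by norm_num) (five_le hD hD4)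
  have hlog : Real.log D ≤ D.size := (G_le hD hD4 0 0).1
  -- `R ≤ 2^{3 size D + 2}`
  have hRle : Real.log (fundUnit D) ≤ (2 : ℝ) ^ (3 * D.size + 2) := by
    refine hR.trans ?_
    have hsq : (((2 * D + 2) ^ 2 : ℕ) : ℝ) ≤ 4 * ((2 : ℝ) ^ D.size) ^ 2 := by
      have hn : (2 * D + 2) ^ 2 ≤ 4 * (2 ^ D.size) ^ 2 := by have := Nat.lt_size_self D; nlinarith
      exact_mod_cast hn
    have hs1 : ((D.size : ℕ) : ℝ) + 1 ≤ (2 : ℝ) ^ D.size := by exact_mod_cast Nat.lt_two_pow_self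
    have h0 : 0 ≤ 1 + Real.log D := by have := Real.log_nonneg hD1; linarith
    calc (((2 * D + 2) ^ 2 : ℕ) : ℝ) * (1 + Real.log D) ≤ (4 * ((2 : ℝ) ^ D.size) ^ 2) * (2 : ℝ) ^ D.size :=
          mul_le_mul hsq (by linarith) h0 (by positivity)
      _ = (2 : ℝ) ^ (3 * D.size + 2) := by ring
  have hR0 : 0 ≤ Real.log (fundUnit D) := Real.log_nonneg (one_lt_fundUnit hD hD4).le
  -- sizes
  have hsize : D.size ≤ x.length + 3 := by rw [hDdef, ← hx]; exact size_Dof_le x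
  have hn : coreLen x = 2 * x.length + 2 := coreLen_eq x
  have hexp : 2 * ((2 * x.length + 28) + (3 * D.size + 2)) + 2 ≤ L := by omega
  calc 3 * ((2 : ℝ) ^ (2 * x.length + 28) * Real.log (fundUnit D)) ^ 2
      ≤ 4 * ((2 : ℝ) ^ (2 * x.length + 28) * (2 : ℝ) ^ (3 * D.size + 2)) ^ 2 := by
        have : (2 : ℝ) ^ (2 * x.length + 28) * Real.log (fundUnit D) ≤ (2 : ℝ) ^ (2 * x.length + 28) * (2 : ℝ) ^ (3 * D.size + 2) :=
          mul_le_mul_of_nonneg_left hRle (by positivity)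
        have h0 : 0 ≤ (2 : ℝ) ^ (2 * x.length + 28) * Real.log (fundUnit D) := by positivity
        nlinarith
    _ = (2 : ℝ) ^ (2 * ((2 * x.length + 28) + (3 * D.size + 2)) + 2) := by ring
    _ ≤ (2 : ℝ) ^ L := pow_le_pow_right₀ (by norm_num) hexp
    _ = ((2 ^ L : ℕ) : ℝ) := by push_cast; ring

/-- **Correctness of the post-processor on a good pair of samples** (the concrete instance of
`exists_true_cand` + `result_eq_floor_or_ceil`). [cite: Jozsa2003, §10 (Thm. 6 and step (c))] -/
theorem result_correct_of_goodPair (q : Polynomial ℕ) {x y : List Bool} (hx : decodeNat x = d)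
    {u u' : ℕ} (hu : u < nU (ofPoly q) (coreLen x)) (hu' : u' < nU (ofPoly q) (coreLen x))
    (hL : LofC q (coreLen x) u = LofC q (coreLen x) u') (hLmin : (hallgrenW q).Lmin (coreLen x) ≤ LofC q (coreLen x) u)
    {k l : ℕ} (hk : 1 ≤ k) (hkS : (k : ℝ) ≤ (hallgrenW q).N x * (cycD hsf h2 q x).R) (hl : 1 ≤ l)
    (hlS : (l : ℝ) ≤ (hallgrenW q).N x * (cycD hsf h2 q x).R) (hcop : Nat.Coprime k l)
    (hc : |(cU q x y u : ℝ) - k * (2 ^ LofC q (coreLen x) u : ℕ) / ((hallgrenW q).N x * (cycD hsf h2 q x).R)| ≤ 1 / 2)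
    (hd : |(cU q x y u' : ℝ) - l * (2 ^ LofC q (coreLen x) u : ℕ) / ((hallgrenW q).N x * (cycD hsf h2 q x).R)| ≤ 1 / 2) :
    result q hallgrenOps (hallgrenW q) x y = ⌊(cycD hsf h2 q x).R⌋₊ ∨
      result q hallgrenOps (hallgrenW q) x y = ⌈(cycD hsf h2 q x).R⌉₊ := by
  obtain ⟨hD, hD4⟩ := goodD_Dof hsf h2
  set j := 2 * x.length + 30 with hj
  set Tv := TOf (Dof d) + coreLen x + q.eval (coreLen x) with hTv
  set C := cycD hsf h2 q x with hCdef
  have hC := cycD_toWalkData hsf h2 q hx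
  -- the grid
  have hN64 : 4096 ≤ (hallgrenW q).N x := hallgrenW_N_ge q x
  have hNR : ((hallgrenW q).N x : ℝ) = (2 : ℝ) ^ (2 * x.length + 28) := hallgrenW_N q x
  have hN64r : (4096 : ℝ) ≤ (hallgrenW q).N x := by exact_mod_cast hN64
  have hNpos : (0 : ℝ) < (hallgrenW q).N x := by linarith
  have hδ : (hallgrenW q).δ₀ = 8 := rfl
  have hs₀ : (hallgrenW q).s₀ x = s0Of (Dof d) := by show s0Of (Dof (decodeNat x)) = _; rw [hx]
  have hT : (hallgrenW q).T x = Tv := by show Tx q x = Tv; unfold Tx; rw [hx]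
  have hM : (hallgrenW q).M x = MOf (Dof d) Tv := by show MOf (Dof (decodeNat x)) (Tx q x) = _; unfold Tx; rw [hx]
  have hR : C.R = Real.log (fundUnit (Dof d)) := rfl
  -- `R > 1/4`
  have hR4 : (1 : ℝ) / 4 < Real.log (fundUnit (Dof d)) := by
    have h := HallgrenRegulator.log_two_lt_two_mul_log_fundUnit hD hD4
    have h2l := Real.one_sub_inv_le_log_of_pos (by norm_num : (0 : ℝ) < 2)
    norm_num at h2l; linarith
  have hNR4 : ((hallgrenW q).N x : ℝ) * (1 / 4) ≤ (hallgrenW q).N x * Real.log (fundUnit (Dof d)) :=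
    mul_le_mul_of_nonneg_left hR4.le hNpos.le
  -- the error budget against `1/N`
  have hbudget := Efin_budget hD hD4 Tv j
  have hbN : 1 / (1024 * (2 : ℝ) ^ j) ≤ 1 / ((hallgrenW q).N x : ℝ) := by
    have h2j : (2 : ℝ) ^ j = (2 : ℝ) ^ (2 * x.length + 28) * 4 := by
      rw [hj, show 2 * x.length + 30 = (2 * x.length + 28) + 2 from rfl, pow_add]; norm_num
    rw [hNR, h2j]
    set A := (2 : ℝ) ^ (2 * x.length + 28) with hA
    have hA0 : 0 < A := by rw [hA]; positivity
    apply one_div_le_one_div_of_le hA0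
    linarith
  have hη0 := C.η_nonneg
  have hEfin0 := C.Efin_nonneg (s0Of (Dof d)) Tv (2 * MOf (Dof d) Tv)
  have hinvN : (1 : ℝ) / (hallgrenW q).N x ≤ 1 / 4096 := one_div_le_one_div_of_le (by norm_num) hN64r
  have h8N : (8 : ℝ) / (hallgrenW q).N x ≤ 8 / 4096 := div_le_div_of_nonneg_left (by norm_num) (by norm_num) hN64r
  have hE : C.Efin (s0Of (Dof d)) Tv (2 * MOf (Dof d) Tv) + 2 * C.η ≤ 1 / ((hallgrenW q).N x : ℝ) :=
    hbudget.trans hbN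
  have h2l : (1 : ℝ) / 2 ≤ Real.log 2 := by
    have := Real.one_sub_inv_le_log_of_pos (by norm_num : (0 : ℝ) < 2); norm_num at this; linarith
  -- the true candidate exists
  have hex : ∃ sc ∈ cands q hallgrenOps (hallgrenW q) x y, |(sc : ℝ) - (hallgrenW q).N x * C.R| < 1 := by
    refine exists_true_cand q C hC (lt_of_lt_of_le (by norm_num) hN64) hu hu' hL hLmin (k := k) (l := l) ?_ ?_ hk hkS hl hlS
      hcop hc hd ?_ (by rw [hδ]; exact le_trans (by norm_num) hN64) ?_ ?_ ?_ ?_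
    · rw [hR]; linarith
    · exact three_S_sq_le hsf h2 q hx (by simpa [hallgrenW] using hLmin)
    · rw [hR]; linarith
    · intro sc hsc
      rw [hs₀, hT]
      refine reach_ok hD hD4 Tv j (by rw [hTv]; omega) ?_
      rw [hR] at hsc
      rw [hδ]
      push_cast
      rw [← sub_div, div_le_iff₀ hNpos]
      have e : (Real.log (fundUnit (Dof d)) + 2) * ((hallgrenW q).N x : ℝ) =
          ((hallgrenW q).N x : ℝ) * Real.log (fundUnit (Dof d)) + 2 * (hallgrenW q).N x := by ring
      rw [e]; linarith
    · rw [hs₀, hT, hM]; exact res_ok hD hD4 Tv j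
    · rw [hs₀, hT, hM, hδ]
      push_cast
      have : (1 : ℝ) / (hallgrenW q).N x + 1 / (hallgrenW q).N x < 8 / (hallgrenW q).N x := by
        rw [← add_div, div_lt_div_iff_of_pos_right hNpos]; norm_num
      linarith
    · rw [hs₀, hT, hM, hδ]
      push_cast
      rw [show C.L = Real.log 2 from rfl]
      linarith
  refine result_eq_floor_or_ceil q C hC (le_trans (by norm_num) hN64) ?_ hex
  unfold tol
  rw [hs₀, hT, hM, hδ]
  push_cast
  linarith

end HallgrenGiantStep

end Literature.Computability.Cryptography

end
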